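import Summits.RiemannHypothesis.RiemannHypothesis.Theorems.PfPersistenceGalerkinTestDensity
import Summits.RiemannHypothesis.RiemannHypothesis.Theorems.PfPersistenceTallyTwin
import HarnessLib

/-!
# GAL-1 density in SUP form PROVED: `testToProfileSupDensity : TestToProfileSupDensity`

**mechanism/rigidity campaign; no RH claims.** RH-free (pub-rhpf, cand-3 gen 6; barrier-typer's export request
13:51Z / 14:13Z). The Fejér cut-off profiles of `PfPersistenceGalerkinTestDensity` approximate a smooth even real
test `g` on `[-a, a]` SIMULTANEOUSLY uniformly on `ℝ` (`‖f_k − g‖_∞ ≤ 1/(k+1)`), in mass and in the Markov closed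
form (`TestDensity.tendsto_markovClosedForm`); taking `k` large for all three gives the typer's sup-form density
`TestToProfileSupDensity` (`PfPersistenceTallyTwin`), from which (ii‴) and (ii″) are its projections
(`testToClosedFormDensity_of_sup`, `testToGalerkinFormDensity_of_sup`). Consumed by name by the typer's
`DialReady`-free W2 on the tally domain; nothing here bears on RH.

References: Fejér [folklore]; the two cell files imported above.
-/

set_option linter.dupNamespace false

noncomputable section

open Set MeasureTheory Filter
open scoped Topology

namespace Summit.RiemannHypothesis.RiemannHypothesis.Theorems.PfPersistence

open Literature.NumberTheory.LFunctions
open TestDensity FejerProfile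

/-- **GAL-1 DENSITY, SUP FORM — PROVED** (`TestToProfileSupDensity`): for a smooth even real test `g` with
`tsupport g ⊆ [-a, a]` and `δ > 0` some cut-off profile `f = cutoffProfile (a, N) v` has `‖f − g‖_∞ ≤ δ` on `ℝ`,
`|‖f‖² − ‖g‖²| ≤ δ` and `|(P + 𝓔_a − M_a‖·‖²)(f) − (P + 𝓔_a − M_a‖·‖²)(g)| ≤ δ`. RH-free. [folklore] -/
theorem testToProfileSupDensity : TestToProfileSupDensity := by
  intro a ha g hg hs hev hre δ hδ
  obtain ⟨K, hK, hnear⟩ := exists_cutoffProfile_near ha hg hs hev hre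
  have hε0 : ∀ k : ℕ, (0 : ℝ) < 1 / ((k : ℝ) + 1) := fun k ↦ by positivity
  have hε1 : ∀ k : ℕ, 1 / ((k : ℝ) + 1) ≤ 1 := fun k ↦
    div_le_one_of_le₀ (by linarith [k.cast_nonneg (α := ℝ)]) (by positivity)
  choose N v hsup hlip using fun k : ℕ ↦ hnear (1 / ((k : ℝ) + 1)) (hε0 k)
  obtain ⟨hm, hc⟩ := tendsto_markovClosedForm ha hK hg hs (f := fun k ↦ cutoffProfile ⟨a, N k, ha⟩ (v k))
    (fun k ↦ memLp_cutoffProfile _ _) (fun k x hx ↦ cutoffProfile_eq_zero_of_not_mem _ _ hx)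
    (ε := fun k : ℕ ↦ 1 / ((k : ℝ) + 1)) hε0 hε1 tendsto_one_div_add_atTop_nhds_zero_nat hsup hlip
  obtain ⟨k₁, hk₁⟩ := Metric.tendsto_atTop.1 hm δ hδ
  obtain ⟨k₂, hk₂⟩ := Metric.tendsto_atTop.1 hc δ hδ
  obtain ⟨k₃, hk₃⟩ := exists_nat_one_div_lt hδ
  obtain ⟨k, hk1, hk2, hk3⟩ : ∃ k : ℕ, k₁ ≤ k ∧ k₂ ≤ k ∧ k₃ ≤ k :=
    ⟨max (max k₁ k₂) k₃, (le_max_left _ _).trans (le_max_left _ _),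
      (le_max_right _ _).trans (le_max_left _ _), le_max_right _ _⟩
  refine ⟨N k, v k, fun x ↦ (hsup k x).trans ?_, ?_, ?_⟩
  · have hk3' : (k₃ : ℝ) + 1 ≤ (k : ℝ) + 1 := by
      have : (k₃ : ℝ) ≤ k := Nat.cast_le.2 hk3
      linarith
    exact (one_div_le_one_div_of_le (by positivity) hk3').trans hk₃.le
  · have h := hk₁ k hk1
    rw [Real.dist_eq] at h
    exact h.le
  · have h := hk₂ k hk2
    rw [Real.dist_eq] at h
    exact h.le

end Summit.RiemannHypothesis.RiemannHypothesis.Theorems.PfPersistence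

end
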